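import Summits.BirchSwinnertonDyer.BirchSwinnertonDyer.Theorems.ResidualThetaTransportAtTwoSignedMuSeedAtTwoPlusPlusLocalHalfOfMuPackage
import Literature.NumberTheory.EllipticCurves.Kato2004.IwasawaCohomologyExistsProofs
import HarnessLib

/-!
# Seed crux `SignedMuSeedAtTwoPlus` (stmt-BirchSwinnertonDyer-21438), line `kolyvagin_char_two`: stub S3 `stub_flatDetectsKatoClassModTwo`
# («FLAT ⇒ a genuine Kato class NOT divisible by `2`») IS A COROLLARY OF THE μ-PACKAGE OF S1 — `2 ∤ Col(loc s)` and `Λ`-linearity of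
# `Col ∘ loc` forbid `s = 2y`; so S1 and S3 are ONE displayed package (route-independent; S3's text BY SHAPE)

Cell `bsd-wall`, width seat `bsd-wall-rtt-p4-w2` g8. Sequel of this seat's `…PlusLocalMuRoad` (p645402), `…PlusLocalHalfOfMuPackage` (p645548:
S1's text from the μ-package), `…FineSandwichNegDisc` (p645831), `…PlusLocalMuRoadHabitat` (p646071). THEOREMS ONLY — no definition, no
named fact, no instance, no `sorry`; the package is a displayed hypothesis; nothing about any curve is asserted; closes no item; BSD is NOT
proved by any of this.

## The observation

Line `kolyvagin_char_two` (skeleton 6de47a5c30e9e074) reads (F) `Sel₀(ℚ_∞, W[2^∞])[2]` finite from S2 (Mazur–Rubin at the blind-spot prime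
`2Λ`: a genuine integral Euler-system class `s ∉ 2·𝐇¹_Γ(T₂W)` ⇒ (F)) and S3 (FLAT ⇒ such an `s` exists). The μ-package of S1 (this seat,
`flatPlusLocalHalfAtTwo_of_muPackage`) displays, for the SAME habitat data, a pinned `I`, a `Λ`-linear `col : I.H → P ≤ Λ` and a genuine class
`s` with `¬ C 2 ∣ col s`. But `s = 2 • y` forces `col s = 2 • col y`, i.e. `C 2 ∣ col s` (`not_exists_eq_two_smul_of_not_C_dvd`). Hence, with
the package quantified over EVERY pinned `𝐇¹_Γ`-datum `I` (the dischargers' construction — Kato's `(c,d,a(A))`-lift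
`IwasawaH1Data.existsUnique_lift_of_zetaBody_two` + the `+`/♭ Coleman functional — is uniform in `I`), **S3's text follows BY SHAPE**
(`flatDetectsKatoClassModTwo_of_muPackage`), and the `∀ I`-package implies the `∃ I`-package consumed by the files above
(`muPackage_exists_of_forall`, via `Kato2004.nonempty_iwasawaH1Data_holds`). Net reading for the line: {S1, S3} ⟸ ONE μ-package; the seed ⟸
{μ-package, S2, S4 (✓ modulo modularity, p644374), 21437 (⟸ Abbes–Ullmo)}.

References: [Kobayashi2003] Thm. 6.3 (p. 11), (7.17)–(7.21) (pp. 12–13); [Kato2004Asterisque] Thm. 12.5 (p. 222), §13.1, Ex. 13.3 (pp. 224–225);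
[MazurRubin2004] Thm. 5.3.10; [Otsuki2009] Thm. 3.6, 4.1.
-/

set_option autoImplicit false
-- the Theorems namespace of this sub repeats the summit name by design (D-0017 nested layout)
set_option linter.dupNamespace false

noncomputable section

open scoped Classical NumberField MatrixGroups ModularForm

open WeierstrassCurve Field IsDedekindDomain CongruenceSubgroup
  Literature.NumberTheory.GaloisRepresentations
  Literature.NumberTheory.EllipticCurves Literature.NumberTheory.EllipticCurves.Module
  Literature.NumberTheory.EllipticCurves.ModularForms
  Literature.NumberTheory.EllipticCurves.IwasawaAlgebra Literature.NumberTheory.EllipticCurves.Kobayashi2003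
  Literature.NumberTheory.EllipticCurves.Rank1Residual
  Literature.NumberTheory.EllipticCurves.Kato2004 ZpExtension
  Summit.BirchSwinnertonDyer.Rank1Residual.Supersingular Summit.BirchSwinnertonDyer.Rank1Residual.X1

namespace Summit.BirchSwinnertonDyer.BirchSwinnertonDyer.Theorems

namespace SignedMuAtTwo.PlusLocalMuRoad

/-! ## §1 `p ∤ col s` forbids `s = p • y` -/

section Divisibility

variable {p : ℕ} [Fact p.Prime] {H : Type*} [AddCommGroup H] [_root_.Module (IwasawaAlgebra p) H]

/-- **`p ∤ col s` ⇒ `s ∉ p·H`** for a `Λ`-linear `col : H → P ≤ Λ`: `s = p • y` gives `col s = p · col y`. (The μ-clause of the μ-package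
forbids divisibility of the Euler-system class by `p` in `𝐇¹_Γ` — the input «`s ∉ p𝐇¹`» of the blind-spot Kolyvagin argument.)
[cite: Kobayashi2003, Thm. 6.3 (p. 11)] [cite: MazurRubin2004, Thm. 5.3.10 (hypothesis: the prime pΛ is not a blind spot)] -/
theorem not_exists_eq_smul_of_not_C_dvd (P : Submodule (IwasawaAlgebra p) (IwasawaAlgebra p))
    (col : H →ₗ[IwasawaAlgebra p] P) (s : H) (h : ¬ PowerSeries.C (p : ℤ_[p]) ∣ (P.subtype (col s))) :
    ¬ ∃ y : H, s = (p : IwasawaAlgebra p) • y := by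
  rintro ⟨y, rfl⟩
  refine h ⟨P.subtype (col y), ?_⟩
  rw [map_smul, map_smul, smul_eq_mul, ← map_natCast (PowerSeries.C (R := ℤ_[p])) p]

end Divisibility

/-! ## §2 `p = 2`: S3 `FlatDetectsKatoClassModTwo` BY SHAPE from the `∀ I`-form of the habitat μ-package -/

section AtTwo

/-- **S3 `stub_flatDetectsKatoClassModTwo` (text VERBATIM) from the habitat⁺ μ-PACKAGE quantified over every pinned `𝐇¹_Γ(T₂W)`-datum `I`
(and every pinned `D`).** For habitat⁺ `W`, newform/`ϖ`/Pollack pair with the FLAT scalar, cyclotomic `κ` with topological generator `γ` and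
`I`: the package (at the canonical pinned datum `Kobayashi2003.signedSelmerDualData`) supplies a genuine `2`-adic Euler-system class `s` with
`¬ C 2 ∣ col s`, hence `s ≠ 2 • y` for every `y` (`not_exists_eq_smul_of_not_C_dvd`). [cite: Kato2004Asterisque, Thm. 12.5 (p. 222) and §13.1 (p. 224)]
[cite: Kobayashi2003, Thm. 6.3 (p. 11)] [cite: MazurRubin2004, Thm. 5.3.10] -/
theorem flatDetectsKatoClassModTwo_of_muPackage
    (hPkg : ∀ (W : WeierstrassCurve ℚ) [W.IsElliptic] [W.IsGloballyMinimal], ¬ W.HasCM → W.analyticRank = 0 →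
      GoodSS W 2 → W.frobeniusTrace 2 = 0 → W.Δ < 0 →
      ∀ [NeZero (W.conductorNorm ℤ)] (f : CuspForm (Gamma0 (W.conductorNorm ℤ)) 2), IsNewformOf W f →
      ∀ (ϖ : ℚ), (ϖ : ℝ) * W.realPeriodRat = plusPeriod f →
      ∀ (Lplus Lminus : IwasawaAlgebra 2), IsPollackPair f 2 Lplus Lminus →
      padicValRat 2 ϖ + MuLambda.mu Lminus = 0 →
      ∀ [ContinuousSMul ℤ_[2] (W.tateModule 2)] [Module.Free ℤ_[2] (W.tateModule 2)]
        [Module.Finite ℤ_[2] (W.tateModule 2)]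
        (κ : ZpExtension ℚ 2) (γ : Field.absoluteGaloisGroup ℚ) (hκ : κ.IsCyclotomic), κ.IsTopGenerator γ →
      ∀ (I : Kato2004.IwasawaH1Data W 2 κ γ) (D : SignedSelmerDualData W κ γ 1),
      ∃ (Y : W.FineSelmerDualData κ γ) (P : Submodule (IwasawaAlgebra 2) (IwasawaAlgebra 2))
        (col : I.H →ₗ[IwasawaAlgebra 2] P) (j : P →ₗ[IwasawaAlgebra 2] D.X)
        (k : D.X →ₗ[IwasawaAlgebra 2] Y.X) (s : I.H),
        (∀ x : I.H, j (col x) = 0) ∧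
        (∀ (x : D.X) (t : W.fineSelmerInfty κ),
          Y.toDual (k x) t = D.toDual x (AddSubgroup.inclusion (fineSelmerInfty_le_signedSelmerInfty W κ 1) t)) ∧
        LinearMap.ker k ≤ LinearMap.range j ∧
        Kato2004.IsEulerSystemClassTwo W hκ I s ∧ ¬ PowerSeries.C (2 : ℤ_[2]) ∣ (P.subtype (col s))) :
    ∀ (W : WeierstrassCurve ℚ) [W.IsElliptic] [W.IsGloballyMinimal], ¬ W.HasCM → W.analyticRank = 0 →
      GoodSS W 2 → W.frobeniusTrace 2 = 0 → W.Δ < 0 →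
      ∀ [NeZero (W.conductorNorm ℤ)] (f : CuspForm (Gamma0 (W.conductorNorm ℤ)) 2), IsNewformOf W f →
      ∀ (ϖ : ℚ), (ϖ : ℝ) * W.realPeriodRat = plusPeriod f →
      ∀ (Lplus Lminus : IwasawaAlgebra 2), IsPollackPair f 2 Lplus Lminus →
      padicValRat 2 ϖ + MuLambda.mu Lminus = 0 →
      ∀ [ContinuousSMul ℤ_[2] (W.tateModule 2)] [Module.Free ℤ_[2] (W.tateModule 2)]
        [Module.Finite ℤ_[2] (W.tateModule 2)]
        (κ : ZpExtension ℚ 2) (γ : Field.absoluteGaloisGroup ℚ) (hκ : κ.IsCyclotomic), κ.IsTopGenerator γ →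
      ∀ (I : Kato2004.IwasawaH1Data W 2 κ γ),
        ∃ s : I.H, Kato2004.IsEulerSystemClassTwo W hκ I s ∧ ¬ ∃ y : I.H, s = (2 : IwasawaAlgebra 2) • y := by
  intro W _ _ hCM hr hss ha hΔ _ f hf ϖ hϖ Lplus Lminus hP hflat _ _ _ κ γ hκ hγ I
  obtain ⟨Y, P, col, j, k, s, -, -, -, hES, hμ⟩ :=
    hPkg W hCM hr hss ha hΔ f hf ϖ hϖ Lplus Lminus hP hflat κ γ hκ hγ I (signedSelmerDualData W κ 1 hγ)
  refine ⟨s, hES, ?_⟩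
  have h := not_exists_eq_smul_of_not_C_dvd P col s hμ
  rwa [Nat.cast_ofNat] at h

/-- **The `∀ I`-package implies the `∃ I`-package** consumed by `flatPlusLocalHalfAtTwo_of_muPackage` /
`signedMuSeedAtTwoPlus_of_fine_of_muPackage` (a pinned `𝐇¹_Γ(T₂W)`-datum exists: `Kato2004.nonempty_iwasawaH1Data_holds`).
[cite: Kato2004Asterisque, §12.2 (p. 220) and Thm. 12.4 (p. 221)] -/
theorem muPackage_exists_of_forall
    (hPkg : ∀ (W : WeierstrassCurve ℚ) [W.IsElliptic] [W.IsGloballyMinimal], ¬ W.HasCM → W.analyticRank = 0 →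
      GoodSS W 2 → W.frobeniusTrace 2 = 0 → W.Δ < 0 →
      ∀ [NeZero (W.conductorNorm ℤ)] (f : CuspForm (Gamma0 (W.conductorNorm ℤ)) 2), IsNewformOf W f →
      ∀ (ϖ : ℚ), (ϖ : ℝ) * W.realPeriodRat = plusPeriod f →
      ∀ (Lplus Lminus : IwasawaAlgebra 2), IsPollackPair f 2 Lplus Lminus →
      padicValRat 2 ϖ + MuLambda.mu Lminus = 0 →
      ∀ [ContinuousSMul ℤ_[2] (W.tateModule 2)] [Module.Free ℤ_[2] (W.tateModule 2)]
        [Module.Finite ℤ_[2] (W.tateModule 2)]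
        (κ : ZpExtension ℚ 2) (γ : Field.absoluteGaloisGroup ℚ) (hκ : κ.IsCyclotomic), κ.IsTopGenerator γ →
      ∀ (I : Kato2004.IwasawaH1Data W 2 κ γ) (D : SignedSelmerDualData W κ γ 1),
      ∃ (Y : W.FineSelmerDualData κ γ) (P : Submodule (IwasawaAlgebra 2) (IwasawaAlgebra 2))
        (col : I.H →ₗ[IwasawaAlgebra 2] P) (j : P →ₗ[IwasawaAlgebra 2] D.X)
        (k : D.X →ₗ[IwasawaAlgebra 2] Y.X) (s : I.H),
        (∀ x : I.H, j (col x) = 0) ∧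
        (∀ (x : D.X) (t : W.fineSelmerInfty κ),
          Y.toDual (k x) t = D.toDual x (AddSubgroup.inclusion (fineSelmerInfty_le_signedSelmerInfty W κ 1) t)) ∧
        LinearMap.ker k ≤ LinearMap.range j ∧
        Kato2004.IsEulerSystemClassTwo W hκ I s ∧ ¬ PowerSeries.C (2 : ℤ_[2]) ∣ (P.subtype (col s))) :
    ∀ (W : WeierstrassCurve ℚ) [W.IsElliptic] [W.IsGloballyMinimal], ¬ W.HasCM → W.analyticRank = 0 →
      GoodSS W 2 → W.frobeniusTrace 2 = 0 → W.Δ < 0 →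
      ∀ [NeZero (W.conductorNorm ℤ)] (f : CuspForm (Gamma0 (W.conductorNorm ℤ)) 2), IsNewformOf W f →
      ∀ (ϖ : ℚ), (ϖ : ℝ) * W.realPeriodRat = plusPeriod f →
      ∀ (Lplus Lminus : IwasawaAlgebra 2), IsPollackPair f 2 Lplus Lminus →
      padicValRat 2 ϖ + MuLambda.mu Lminus = 0 →
      ∀ [ContinuousSMul ℤ_[2] (W.tateModule 2)] [Module.Free ℤ_[2] (W.tateModule 2)]
        [Module.Finite ℤ_[2] (W.tateModule 2)]
        (κ : ZpExtension ℚ 2) (γ : Field.absoluteGaloisGroup ℚ) (hκ : κ.IsCyclotomic), κ.IsTopGenerator γ →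
      ∀ (D : SignedSelmerDualData W κ γ 1),
      ∃ (I : Kato2004.IwasawaH1Data W 2 κ γ) (Y : W.FineSelmerDualData κ γ)
        (P : Submodule (IwasawaAlgebra 2) (IwasawaAlgebra 2))
        (col : I.H →ₗ[IwasawaAlgebra 2] P) (j : P →ₗ[IwasawaAlgebra 2] D.X)
        (k : D.X →ₗ[IwasawaAlgebra 2] Y.X) (s : I.H),
        (∀ x : I.H, j (col x) = 0) ∧
        (∀ (x : D.X) (t : W.fineSelmerInfty κ),
          Y.toDual (k x) t = D.toDual x (AddSubgroup.inclusion (fineSelmerInfty_le_signedSelmerInfty W κ 1) t)) ∧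
        LinearMap.ker k ≤ LinearMap.range j ∧
        Kato2004.IsEulerSystemClassTwo W hκ I s ∧ ¬ PowerSeries.C (2 : ℤ_[2]) ∣ (P.subtype (col s)) := by
  intro W _ _ hCM hr hss ha hΔ _ f hf ϖ hϖ Lplus Lminus hP hflat _ _ _ κ γ hκ hγ D
  obtain ⟨I⟩ := Kato2004.nonempty_iwasawaH1Data_holds W 2 κ γ hκ hγ
  obtain ⟨Y, P, col, j, k, s, h⟩ := hPkg W hCM hr hss ha hΔ f hf ϖ hϖ Lplus Lminus hP hflat κ γ hκ hγ I D
  exact ⟨I, Y, P, col, j, k, s, h⟩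

end AtTwo

end SignedMuAtTwo.PlusLocalMuRoad

end Summit.BirchSwinnertonDyer.BirchSwinnertonDyer.Theorems

end
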